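import Literature.MathematicalPhysics.QuantumFieldTheory.Balaban1983to89.T4YoungHosting

/-!
# `Balaban1983to89.T4MatchingClosureHosts` — BY-NAME SEAM (δ): the node-U5 closure's per-term step-data binder `hsteps`
(its one remaining binder over ABSTRACT step profiles) DISCHARGED from cutoff-indexed hosted two-run data; the closure per
string, end to end, at PRODUCER LEVEL, and the plug of all strings into node U0
(cell `pub-balaban`, SURGE NODE PROVER #02 lineage = node-U5 closure / assembler; T4-DAG v16 U5 block; journal self-row
T4-U5.E-CLOSE*-HOSTS; record `t4/T4-EST-U5.md` §0 (r); imports unit pv25's `T4YoungHosting` v1 (p184673) ONLY — which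
carries this lineage's `T4MatchingClosureBirth` (p184379) and, through it, `…TwoRun` / `…Young` / `…Fed` / `…Rem` /
`T4MatchingClosure` / `T4MatchingAssembly` — and modifies nothing)

HONEST FRAMING (cell `pub-balaban`, T4-DAG PAGE 1).  The cell's T4 target is the existence AND uniqueness of the
continuum limit of Bałaban's unit-scale averaged loop expectations on a finite torus — strictly beyond ultraviolet
stability ([Balaban1988Convergent] Cor. 3 p. 264; [Balaban1989LargeFieldII] Thm 1 p. 355); it is NOT infinite volume,
NOT a mass gap, NOT the Clay problem.  This module is KERNEL BOOKKEEPING ONLY (three compositions; 0 estimates,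
0 definitions).  It is the fourth seam of the node-U5 two-run matching design — after it NO binder on the closure's remnant
side is an abstract profile (window, rate or step data) — written BY NAME on landed leaves:
* THE CONSUMER (`T4MatchingClosureYoung` §3/§3b, this lineage gen 12): `hybridNE7_closure_fed_steps_youngWindow` /
  `stringHybridNE7_closure_fed_steps_youngWindow` — the node-U5 closure fed from per-step data at Lemma Y's canonical
  young window, whose ONLY binder not yet resolved to producer obligations is the per-term step data
  `hsteps : ∀ K t, |t| ≤ l₀ → ∀ τ ∈ T K \ Bad K t, ∃ rad ry Qy Qo, StepBudget C C′ θ ρ E C_r vol Λ (youngWindow …) K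
  rad ry Qy Qo ∧ RrRem K t τ ≤ Σ_{j ∈ [jlog_C K, K]} rad j` (a BINDER, instantiated for nothing);
* THE PRODUCER (unit pv25 gen 9, `T4YoungHosting` §4): `steps_feed_of_twoRun_bankYoung` — at ONE cutoff `K`, for ONE
  term, exactly that existential, from two-run polymer-gas data on the log window (seam (β), unit pv05's
  Kotecký–Preiss level), birth-step two-run rates on the BANK-YOUNG discrepant polymers (seam (γ)), each of them HOSTED
  by a geometric genealogy ledger (`Hosts`, Lemma Y end to end), the old-born SIZE on the others, the cube counts and
  the domination of the term's remnant radius by its ledger's leaf sums — every one of these a named binder there.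

WHAT THIS LEAF DOES, EXACTLY (no over-claim).  (§1) `hybridNE7_closure_hosts` = the consumer's hybrid-level theorem with
`hsteps` REPLACED by the producer's binders, supplied PER CUTOFF `K`, PER SOURCE `t` with `|t| ≤ l₀` and PER GOOD TERM
`τ ∈ T K \ Bad K t` — literally the range `hsteps` quantifies over — and the two closure-side sign binders `hE`, `hCg`
GONE (`E := A_kp·e^{b_kp + τ_kp c₁}·K_kp ≥ 0` from `0 ≤ A_kp`, `0 ≤ K_kp`; `C_g := modelC dd ≥ 1` by
`T4EpochSize.one_le_modelC`); the producer's `θ ≤ 1`, `0 ≤ ρ` are the closure's `θ < 1`, `0 < ρ`.  (§1b)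
`stringHybridNE7_closure_hosts` = the same per string of a torus scheme, end to end: producer-level binders + the two
partition-function identifications ⇒ `∃ K₁, StringHybridNE7 S os l₀ vol (K₀ + K₁)`.  (§2)
`hasContinuumLimit_of_stringClosures` = the plug of ALL strings into the node-U0 targets
(`HasContinuumLimit S ∧ HasUniqueLimitPoints S ∧ LimitPointsAgree S`) through this lineage's
`T4MatchingAssembly.hasContinuumLimit_of_hybridNE7`, in the form every per-string closure theorem of the lineage
(`stringHybridNE7_closure` / `_remnant` / `_remnantW` / `_fed` / `_fed_steps` / `_youngWindow` / `_fed_steps_youngWindow`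
/ `_hosts`) concludes: `∀ os, ∃ vol K₀ K₁, 0 < vol ∧ StringHybridNE7 S os l₀ vol (K₀ + K₁)`.

TYPING DECISIONS (recorded so that a cross-reader can diff binder groups 1:1 against the two parents).
(T1) CUTOFF-INDEXED TYPES.  The polymer and cube types are families `Dom Cube : ℕ → Type*` with per-cutoff instances
(`DecidableEq`, `Fintype (Dom K)`, the incompatibility relation `inc K` decidable, reflexive, symmetric), because seam (β)
SUMS over `Fintype Dom` (the Kotecký–Preiss majorant): one finite polymer type for all cutoffs would be vacuous in spirit.
The lineage-name type `κ`, region-name type `η`, the ledger's leaf / operation types `ιL`, `Op` carry no finiteness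
hypothesis and stay single abstract types.
(T2) PER-TERM DATA.  Catalogues, footprints, reach, size function, the two activity families, genealogy ledgers, birth
map, cleanliness predicates, anchoring cube sets, the term's nested ledger with its remnant leaves and domains are
families indexed by `(K, t, τ)`, and each of the producer's 22 per-term hypotheses (`hDisc hloc hreach hdsz hwAΛ hwBΛ hwA
hwB hzero hbirth hhost hsizeA hsizeB h126 hvol hQy hQo hQyc hQoc hnd hinj hRem`) is asked ONLY on that range, under the
prefix `∀ K t, |t| ≤ l₀ → ∀ τ ∈ T K \ Bad K t`.  ONE flow of (I.0.20) per cutoff (`F K`, windows `Rw K`; binders `hpos hle1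
hrg hub hRj hxK hcK` per `K`), as in seam (γ).
(T3) UNIFORM CONSTANTS (the point of the closure: nothing may drift with the cutoff): the log-cut constants `C, C′`, the
rates `θ, ρ`, `C_r`, `Λ`, `vol`; the Kotecký–Preiss regime of seam (β) — RENAMED here `Akp Rkp r₁ skp κ₀ Kkp c₁ bkp τkp
νkp` for the producer's `A R r₁ s κ₀ K₀ c₁ b τ ν`, because at the composed level `A, B` are the closure's term weights,
`s, ν` its producer rates, `K₀` the string's first cutoff and `τ` its term variable; the S-side constants `c_e, c_s, p̄₀`
with (P5); the flow majorants `β′, x̄, c̄`; `L_b, r` of the typed (2.5) windows (the consumer's `Lb, rr`, the producer's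
`L₁, r`); `Nsz`; the lattice dimension `dd` of the genealogy ledgers; the producer's size function `d` is `dsz`, its
incompatibility relation `ι` is `inc`, its genealogy ledgers `G` are `Gl`, its nested ledger `t` is `led` (here `t` is
the source and, in §1b, `G` the gauge group).
(T4) Binder ORDER: the consumer's binders in the consumer's order with `hE`, `hCg` deleted and `hCr` added after `hθ1`;
in the slot of `hsteps`: uniform producer binders, the flow block, the data families, the 22 per-term binders in the
producer's order; then the consumer's tail (`hr hu hs hs₂`; in §1b `hZA hZB`).

NOT DONE HERE (the producers' obligations; NOT PRINTED as such; proved nowhere in the tree) — unchanged from seams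
(β)/(γ) and `T4YoungHosting`, now visible in ONE binder list per string: that Bałaban's two runs' k-th densities ARE
polymer gases on common catalogues in the Kotecký–Preiss regime with (1.26)_rel, the volume bound, footprint locality
and the KP smallness (cell nodes U5a / NE-R1; print's one-run, AGE-FREE activity format [Balaban1989LargeFieldII] (1.97)
foot of p. 389, (1.98)–(1.100) p. 390 — LOCATIONS, nothing quoted); the two-run rate `C_r·θ^{birth}` AT THE ACTIVITY
LEVEL on bank-young discrepant polymers (`hbirth`; NE2⁺-LF / NE-R1 two-run half); that the sub-history hosting a young
polymer IS a hosted geometric genealogy ledger (`hhost`; the pv25 lineage's standing identification, record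
`t4/T4-EST-U5E-rem.md` §4); the old-born SIZE `ρ^{A(K)}` (`hsizeA/B`); the S-side credits, ONE flow per cutoff with its
(2.5) windows and UNIFORM majorants `x̄ ≥ log g_K(K)^{−2}`, `c̄ ≥ g_K(K)²β′` (renormalization conditions at the last
scale, binders `hxK hcK`); the cube counts `hQyc hQoc`; the domination `hRem` of the closure's remnant radius by leaf sums;
and, on the closure side, the weight / shell halves, the split budget `hSB` (seven clauses) and four summable producer
rates.  No `StepBudget` / `RemnantSplitBudget` / `Hosts` is INSTANTIATED for Bałaban's objects (cell ABSOLUTE RULE;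
lineage handoff (R3)): every estimate is a binder over abstract types and abstract activities.

ABSOLUTE RULE.  NOTHING of [Balaban 1983–89] is quoted as authority or asserted here; no display is transcribed; no
programme-internal claim is cited; no `[cite:]` tag; page numbers are LOCATIONS.  Every declaration is [folklore]
bookkeeping over `T4MatchingClosureYoung` §3/§3b, `T4YoungHosting` §4 and `T4MatchingAssembly` §5.

CONTENTS.  §1 `hybridNE7_closure_hosts`.  §1b `stringHybridNE7_closure_hosts`.  §2 `hasContinuumLimit_of_stringClosures`.
Non-vacuity is inherited and not re-proved: the producer's hypothesis block is inhabited by the empty catalogue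
(`T4MatchingClosureTwoRun` §4, `T4MatchingClosureBirth` §4) and the closure's by `T4MatchingClosure` §8 /
`T4MatchingClosureYoung` §5.

Value = kernel certificate of THE USER-FACING BINDER LIST OF NODE U5 AT PRODUCER LEVEL — per string and for all cutoffs,
every hypothesis of the continuum-limit closure is now, by name, a producer obligation of a named cell node or a sign /
summability condition on a uniform constant, and all strings plug into node U0; NOT an estimate, NOT summit progress.
Rung (B)+1 (finite `T⁴`), NOT continuum YM in infinite volume, NOT Clay.  Unit `b2b-balaban-pv02` gen 14 (journal CLAIM
T4-U5.E-CLOSE*-HOSTS 2026-08-19T07:55:57Z).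
-/

open Finset

namespace Literature.MathematicalPhysics.QuantumFieldTheory.Balaban1983to89.T4MatchingClosureHosts

open Literature.MathematicalPhysics.QuantumFieldTheory.Balaban1983to89
open Literature.Probability.LatticeModels
open T4CauchySum T4GoodClassBudget T4HistoryPeeling T4MatchingAssembly T4MatchingClosure T4RemnantBooking
  T4MatchingClosureRem T4MatchingClosureFed T4BankAgeYoung T4MatchingClosureYoung
open B13FamilySum B16Exp198 B16Exp198TwoRun T4NestedLevels T4TwoRunRateAssembly T4MatchingClosureTwoRun
  T4MatchingClosureBirth T4GeometricLedger T4YoungHosting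

/-! ## §1 The hybrid-level closure with `hsteps` discharged from cutoff-indexed hosted two-run data -/

section HybridHosts

variable {ι : Type*} [DecidableEq ι] {l₀ vol : ℝ} {T : ℕ → Finset ι} {A B Acore Bcore : ℕ → ℝ → ι → ℝ}
  {Bad : ℕ → ℝ → Finset ι} {Cc Rr CcRec RrRec RrRem : ℕ → ℝ → ι → ℝ} {ν u' s₂ c₀ r' s L : ℕ → ℝ}
  {Λ C' ρ θ Cr x c : ℝ} {dd Lb rr : ℕ}
variable {Dom Cube : ℕ → Type*} [∀ K, DecidableEq (Dom K)] [∀ K, DecidableEq (Cube K)]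
  (inc : (K : ℕ) → Dom K → Dom K → Prop) [∀ K, DecidableRel (inc K)] [∀ K, Fintype (Dom K)]
  [∀ K, Std.Refl (inc K)] [∀ K, Std.Symm (inc K)]
  {κ η : Type*} [DecidableEq κ] [DecidableEq η] {ιL Op : Type*} [DecidableEq ιL]

/-- **THE NODE-U5 CLOSURE AT PRODUCER LEVEL** (= `T4MatchingClosureYoung.hybridNE7_closure_fed_steps_youngWindow` with
its per-term step-data binder `hsteps` DISCHARGED, for every cutoff `K`, source `|t| ≤ l₀` and good term
`τ ∈ T K \ Bad K t`, by ONE application of `T4YoungHosting.steps_feed_of_twoRun_bankYoung (inc K)` to cutoff-indexed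
data; `E := A_kp·e^{b_kp + τ_kp c₁}·K_kp`, `C_g := modelC dd`, so the consumer's `hE`, `hCg` are theorems).
USER-FACING BINDERS: the consumer's weight / shell / log-cut / split-budget / summability binders verbatim; the uniform
producer constants with their signs, `hrate′`, `hsmall`, (P5); ONE flow per cutoff with (2.5) windows and uniform
majorants; and the producer's 22 per-term hypotheses on the range of `hsteps` (typing decisions (T1)–(T4) of the
module docstring).  CONDITIONAL; nothing PRINTED is asserted; nothing instantiated. [folklore] -/
theorem hybridNE7_closure_hosts {r₀ V C : ℝ} (h0 : 0 < r₀) (h1 : r₀ < 1) (hV : 0 ≤ V)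
    (hC : 1 < C * (-Real.log r₀))
    (hA : ∀ K t, |t| ≤ l₀ → ∀ τ ∈ T K, 0 ≤ A K t τ) (hB : ∀ K t, |t| ≤ l₀ → ∀ τ ∈ T K, 0 ≤ B K t τ)
    (hDA : SlotDom l₀ T A Bad fun K => V * r₀ ^ (K - jlogOf C K))
    (hDB : SlotDom l₀ T B Bad fun K => V * r₀ ^ (K - jlogOf C K))
    (hL0 : ∀ K, 0 ≤ L K) (hLs : Summable L)
    (hA0 : ∀ K t, |t| ≤ l₀ → ∀ τ ∈ T K, 0 ≤ Acore K t τ)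
    (hAlo : ∀ K t, |t| ≤ l₀ → ∀ τ ∈ T K, Acore K t τ ≤ A K t τ)
    (hAhi : ∀ K t, |t| ≤ l₀ → ∀ τ ∈ T K, A K t τ ≤ Real.exp (L K) * Acore K t τ)
    (hB0 : ∀ K t, |t| ≤ l₀ → ∀ τ ∈ T K, 0 ≤ Bcore K t τ)
    (hBlo : ∀ K t, |t| ≤ l₀ → ∀ τ ∈ T K, Bcore K t τ ≤ B K t τ)
    (hBhi : ∀ K t, |t| ≤ l₀ → ∀ τ ∈ T K, B K t τ ≤ Real.exp (L K) * Bcore K t τ)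
    (hΛ : 1 ≤ Λ) (hρ0 : 0 < ρ) (hρ1 : ρ < 1)
    (hq : ((⌈C * Real.log Λ⌉₊ : ℕ) : ℝ) + 3 ≤ C' * (-Real.log ρ)) (hθ : 0 < θ) (hθ1 : θ < 1) (hCr : 0 ≤ Cr)
    (hx : 0 ≤ x) (hc : 0 ≤ c)
    (hSB : RemnantSplitBudget l₀ vol T Acore Bcore Bad Cc Rr CcRec RrRec RrRem ν u' s₂ c₀ r' s)
    -- ─── in the slot of `hsteps`: the producer's binders (uniform / per cutoff / per term) ───
    {Akp Rkp r₁ skp κ₀ Kkp c₁ bkp τkp νkp : ℝ}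
    (hAkp : 0 ≤ Akp) (hKkp : 0 ≤ Kkp) (hτkp : 0 ≤ τkp) (hr₁ : 0 ≤ r₁) (hskp : 0 ≤ skp) (hbkp : 0 ≤ bkp)
    (hrate' : κ₀ + (r₁ + skp) + τkp * c₁ ≤ Rkp) (hsmall : Akp * Real.exp (bkp + τkp * c₁) * Kkp * νkp ≤ τkp)
    (hdd : 1 ≤ dd) {ce cs p₀ : ℝ} (hce : 0 < ce) (hp : 0 < p₀) (hP5 : ce ≤ cs * p₀)
    (F : ℕ → Flow) {β' : ℝ} (hβ' : 0 ≤ β') (hL : 1 ≤ Lb)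
    (hpos : ∀ K j, j ≤ K → 0 < (F K).g j) (hle1 : ∀ K j, j ≤ K → (F K).g j ≤ 1) (hrg : ∀ K, (F K).SatisfiesRG K)
    (hub : ∀ K j, j < K → (F K).β (j + 1) ((F K).g j) ≤ β') (Rw : ℕ → ℕ → ℕ)
    (hRj : ∀ K j, j ≤ K → B14.IsRj Lb rr ((F K).g j) (Rw K j))
    (hxK : ∀ K, Real.log (((F K).g K) ^ 2)⁻¹ ≤ x) (hcK : ∀ K, ((F K).g K) ^ 2 * β' ≤ c)
    {Nsz : ℕ} (hNsz : 64 ≤ Nsz)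
    {Cat Disc : (K : ℕ) → ℝ → ι → ℕ → Finset (Dom K)}
    {cubes out reach : (K : ℕ) → ℝ → ι → ℕ → Dom K → Finset (Cube K)} {dsz : (K : ℕ) → ℝ → ι → ℕ → Dom K → ℝ}
    {wA wB : (K : ℕ) → ℝ → ι → ℕ → Dom K → ℂ}
    (Gl : (K : ℕ) → ℝ → ι → ℕ → Dom K → GeoLedger dd κ η) (birth : (K : ℕ) → ℝ → ι → ℕ → Dom K → ℕ)
    (Clean : (K : ℕ) → ℝ → ι → ℕ → Dom K → ℕ → ℕ → Prop) {Qy Qo : (K : ℕ) → ℝ → ι → ℕ → Finset (Cube K)}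
    (led : ℕ → ℝ → ι → Ledger ιL Op) (rem : ℕ → ℝ → ι → ℕ → Finset ιL)
    (dom : (K : ℕ) → ℝ → ι → ιL → Finset (Cube K))
    (hDisc : ∀ K t, |t| ≤ l₀ → ∀ τ ∈ T K \ Bad K t, ∀ j, Disc K t τ j ⊆ Cat K t τ j)
    (hloc : ∀ K t, |t| ≤ l₀ → ∀ τ ∈ T K \ Bad K t,
      ∀ j Z, ∀ Z' ∈ Cat K t τ j, inc K Z' Z → ∃ q ∈ reach K t τ j Z, q ∈ out K t τ j Z')
    (hreach : ∀ K t, |t| ≤ l₀ → ∀ τ ∈ T K \ Bad K t,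
      ∀ j Z, ((reach K t τ j Z).card : ℝ) ≤ νkp * (out K t τ j Z).card)
    (hdsz : ∀ K t, |t| ≤ l₀ → ∀ τ ∈ T K \ Bad K t, ∀ j Z, 0 ≤ dsz K t τ j Z)
    (hwAΛ : ∀ K t, |t| ≤ l₀ → ∀ τ ∈ T K \ Bad K t, ∀ j Z, Z ∉ Cat K t τ j → wA K t τ j Z = 0)
    (hwBΛ : ∀ K t, |t| ≤ l₀ → ∀ τ ∈ T K \ Bad K t, ∀ j Z, Z ∉ Cat K t τ j → wB K t τ j Z = 0)
    (hwA : ∀ K t, |t| ≤ l₀ → ∀ τ ∈ T K \ Bad K t,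
      ∀ j Z, ‖wA K t τ j Z‖ ≤ Akp * Real.exp (-(Rkp * dsz K t τ j Z)))
    (hwB : ∀ K t, |t| ≤ l₀ → ∀ τ ∈ T K \ Bad K t,
      ∀ j Z, ‖wB K t τ j Z‖ ≤ Akp * Real.exp (-(Rkp * dsz K t τ j Z)))
    (hzero : ∀ K t, |t| ≤ l₀ → ∀ τ ∈ T K \ Bad K t,
      ∀ j, ∀ Z ∈ Cat K t τ j, Z ∉ Disc K t τ j → wA K t τ j Z = wB K t τ j Z)
    (hbirth : ∀ K t, |t| ≤ l₀ → ∀ τ ∈ T K \ Bad K t, ∀ j ∈ Icc (jlogOf C K) K, ∀ Z ∈ Disc K t τ j,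
      BankYoung₂ (Gl K t τ j Z) ce cs p₀ C' K →
        ‖wA K t τ j Z - wB K t τ j Z‖ ≤ Cr * θ ^ birth K t τ j Z * (Akp * Real.exp (-(Rkp * dsz K t τ j Z))))
    (hhost : ∀ K t, |t| ≤ l₀ → ∀ τ ∈ T K \ Bad K t, ∀ j ∈ Icc (jlogOf C K) K, ∀ Z ∈ Disc K t τ j,
      BankYoung₂ (Gl K t τ j Z) ce cs p₀ C' K →
        Hosts (Gl K t τ j Z) (birth K t τ j Z) j Nsz (Rw K) (Clean K t τ j Z))
    (hsizeA : ∀ K t, |t| ≤ l₀ → ∀ τ ∈ T K \ Bad K t, ∀ j ∈ Icc (jlogOf C K) K, ∀ Z ∈ Disc K t τ j,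
      ¬BankYoung₂ (Gl K t τ j Z) ce cs p₀ C' K →
        ‖wA K t τ j Z‖ ≤ ρ ^ ageCut C' K * (Akp * Real.exp (-(Rkp * dsz K t τ j Z))))
    (hsizeB : ∀ K t, |t| ≤ l₀ → ∀ τ ∈ T K \ Bad K t, ∀ j ∈ Icc (jlogOf C K) K, ∀ Z ∈ Disc K t τ j,
      ¬BankYoung₂ (Gl K t τ j Z) ce cs p₀ C' K →
        ‖wB K t τ j Z‖ ≤ ρ ^ ageCut C' K * (Akp * Real.exp (-(Rkp * dsz K t τ j Z))))
    (h126 : ∀ K t, |t| ≤ l₀ → ∀ τ ∈ T K \ Bad K t, ∀ j, Ineq126 (Cat K t τ j) (out K t τ j) (dsz K t τ j) κ₀ Kkp)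
    (hvol : ∀ K t, |t| ≤ l₀ → ∀ τ ∈ T K \ Bad K t, ∀ j, VolBound (Cat K t τ j) (out K t τ j) (dsz K t τ j) c₁)
    (hQy : ∀ K t, |t| ≤ l₀ → ∀ τ ∈ T K \ Bad K t, ∀ j ∈ Icc (jlogOf C K) K, ∀ Z ∈ Disc K t τ j,
      BankYoung₂ (Gl K t τ j Z) ce cs p₀ C' K → ∃ q ∈ Qy K t τ j, q ∈ out K t τ j Z)
    (hQo : ∀ K t, |t| ≤ l₀ → ∀ τ ∈ T K \ Bad K t, ∀ j ∈ Icc (jlogOf C K) K, ∀ Z ∈ Disc K t τ j,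
      ¬BankYoung₂ (Gl K t τ j Z) ce cs p₀ C' K → ∃ q ∈ Qo K t τ j, q ∈ out K t τ j Z)
    (hQyc : ∀ K t, |t| ≤ l₀ → ∀ τ ∈ T K \ Bad K t,
      ∀ j ∈ Icc (jlogOf C K) K, ((Qy K t τ j).card : ℝ) ≤ vol * Λ ^ (K - j))
    (hQoc : ∀ K t, |t| ≤ l₀ → ∀ τ ∈ T K \ Bad K t,
      ∀ j ∈ Icc (jlogOf C K) K, ((Qo K t τ j).card : ℝ) ≤ vol * Λ ^ (K - j))
    (hnd : ∀ K t, |t| ≤ l₀ → ∀ τ ∈ T K \ Bad K t, (led K t τ).leaves.Nodup)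
    (hinj : ∀ K t, |t| ≤ l₀ → ∀ τ ∈ T K \ Bad K t, ∀ j, Set.InjOn (dom K t τ) ↑(rem K t τ j))
    (hRem : ∀ K t, |t| ≤ l₀ → ∀ τ ∈ T K \ Bad K t,
      RrRem K t τ ≤ ∑ j ∈ Icc (jlogOf C K) K, (led K t τ).leafSum fun i => if i ∈ rem K t τ j then
        ‖locR (inc K) (Cat K t τ j) (cubes K t τ j) (wA K t τ j) (dom K t τ i) -
          locR (inc K) (Cat K t τ j) (cubes K t τ j) (wB K t τ j) (dom K t τ i)‖ else 0)
    -- ─── the consumer's tail ───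
    (hr : Summable r') (hu : Summable u') (hs : Summable s) (hs₂ : Summable s₂) :
    ∃ K₀, HybridNE7 l₀ vol (fun K => T (K₀ + K)) (fun K => A (K₀ + K)) (fun K => B (K₀ + K)) (fun K => Bad (K₀ + K))
      (fun K => 1 - Real.exp (-(V * r₀ ^ (K₀ + K - jlogOf C (K₀ + K)))))
      (fun K t τ => A (K₀ + K) t τ - Acore (K₀ + K) t τ) (fun K t τ => B (K₀ + K) t τ - Bcore (K₀ + K) t τ)
      (fun K => 1 - Real.exp (-L (K₀ + K)))
      (fun K => ((r' (K₀ + K) + ((Akp * Real.exp (bkp + τkp * c₁) * Kkp) * Cr) *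
            remnantYoungW θ Λ C (youngWindow dd Lb rr (T4EpochSize.modelC dd) C' x c) (K₀ + K)) +
          (u' (K₀ + K) + remnantOld (fun _ n => 2 * (Akp * Real.exp (bkp + τkp * c₁) * Kkp) * ρ ^ n) Λ C C'
            (K₀ + K))) + (s (K₀ + K) + s₂ (K₀ + K))) :=
  hybridNE7_closure_fed_steps_youngWindow h0 h1 hV hC hA hB hDA hDB hL0 hLs hA0 hAlo hAhi hB0 hBlo hBhi hΛ
    (mul_nonneg (mul_nonneg hAkp (Real.exp_pos _).le) hKkp) hρ0 hρ1 hq hθ hθ1 (T4EpochSize.one_le_modelC dd) hx hc hSB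
    (fun K t ht τ hτ =>
      steps_feed_of_twoRun_bankYoung (inc K) hθ hθ1.le hCr (hDisc K t ht τ hτ) (hloc K t ht τ hτ)
        (hreach K t ht τ hτ) (hdsz K t ht τ hτ) hAkp hKkp hτkp hρ0.le hr₁ hskp hbkp (hwAΛ K t ht τ hτ)
        (hwBΛ K t ht τ hτ) (hwA K t ht τ hτ) (hwB K t ht τ hτ) (hzero K t ht τ hτ) hdd (Gl K t τ) hce hp hP5
        (birth K t τ) (hbirth K t ht τ hτ) (F K) hβ' hL (hpos K) (hle1 K) (hrg K) (hub K) (Rw K) (hRj K) hx hc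
        (hxK K) (hcK K) hNsz (Clean K t τ) (hhost K t ht τ hτ) (hsizeA K t ht τ hτ) (hsizeB K t ht τ hτ)
        (h126 K t ht τ hτ) (hvol K t ht τ hτ) hrate' hsmall (hQy K t ht τ hτ) (hQo K t ht τ hτ) (hQyc K t ht τ hτ)
        (hQoc K t ht τ hτ) (hnd K t ht τ hτ) (rem K t τ) (hinj K t ht τ hτ) (hRem K t ht τ hτ))
    hr hu hs hs₂

end HybridHosts

/-! ## §1b Per string, end to end, at producer level -/

section SchemeHosts

open Missing T4Continuum T4Assembly

variable {G : Type*} [GaugeGroup G] [MeasurableSpace G] [HaarData G] {O : Type*}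
variable {Dom Cube : ℕ → Type*} [∀ K, DecidableEq (Dom K)] [∀ K, DecidableEq (Cube K)]
  (inc : (K : ℕ) → Dom K → Dom K → Prop) [∀ K, DecidableRel (inc K)] [∀ K, Fintype (Dom K)]
  [∀ K, Std.Refl (inc K)] [∀ K, Std.Symm (inc K)]
  {κ η : Type*} [DecidableEq κ] [DecidableEq η] {ιL Op : Type*} [DecidableEq ιL]

/-- **PER STRING, END TO END, AT PRODUCER LEVEL** (= `T4MatchingClosureYoung.stringHybridNE7_closure_fed_steps_youngWindow`
with `hsteps` DISCHARGED exactly as in §1).  THE USER-FACING BINDER LIST OF NODE U5 for the string `os` from cutoff `K₀`: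
weight / shell halves (`hA … hBhi`), log-cut and sign constants, the split budget `hSB` (seven clauses, remnants
excluded), the uniform producer constants of the polymer-gas regime with `hrate′`, `hsmall`, (P5), ONE flow per cutoff
with typed (2.5) windows and uniform majorants, `Nsz ≥ 64`, the producer's 22 per-term hypotheses on good terms of
sources in the disc, four summable producer rates and the two partition-function identifications `hZA`, `hZB` —
⇒ `∃ K₁, StringHybridNE7 S os l₀ vol (K₀ + K₁)`, literally the per-string hypothesis of §2. [folklore] -/
theorem stringHybridNE7_closure_hosts (S : TorusScheme G O) (os : List O) (K₀ : ℕ) {ι : Type}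
    [DecidableEq ι] {l₀ vol : ℝ} {T : ℕ → Finset ι} {A B Acore Bcore : ℕ → ℝ → ι → ℝ} {Bad : ℕ → ℝ → Finset ι}
    {Cc Rr CcRec RrRec RrRem : ℕ → ℝ → ι → ℝ} {ν u' s₂ c₀ r' s L : ℕ → ℝ}
    {Λ C' ρ θ Cr x c : ℝ} {dd Lb rr : ℕ} {r₀ V C : ℝ}
    (h0 : 0 < r₀) (h1 : r₀ < 1) (hV : 0 ≤ V) (hC : 1 < C * (-Real.log r₀))
    (hA : ∀ K t, |t| ≤ l₀ → ∀ τ ∈ T K, 0 ≤ A K t τ) (hB : ∀ K t, |t| ≤ l₀ → ∀ τ ∈ T K, 0 ≤ B K t τ)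
    (hDA : SlotDom l₀ T A Bad fun K => V * r₀ ^ (K - jlogOf C K))
    (hDB : SlotDom l₀ T B Bad fun K => V * r₀ ^ (K - jlogOf C K))
    (hL0 : ∀ K, 0 ≤ L K) (hLs : Summable L)
    (hA0 : ∀ K t, |t| ≤ l₀ → ∀ τ ∈ T K, 0 ≤ Acore K t τ)
    (hAlo : ∀ K t, |t| ≤ l₀ → ∀ τ ∈ T K, Acore K t τ ≤ A K t τ)
    (hAhi : ∀ K t, |t| ≤ l₀ → ∀ τ ∈ T K, A K t τ ≤ Real.exp (L K) * Acore K t τ)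
    (hB0 : ∀ K t, |t| ≤ l₀ → ∀ τ ∈ T K, 0 ≤ Bcore K t τ)
    (hBlo : ∀ K t, |t| ≤ l₀ → ∀ τ ∈ T K, Bcore K t τ ≤ B K t τ)
    (hBhi : ∀ K t, |t| ≤ l₀ → ∀ τ ∈ T K, B K t τ ≤ Real.exp (L K) * Bcore K t τ)
    (hΛ : 1 ≤ Λ) (hρ0 : 0 < ρ) (hρ1 : ρ < 1)
    (hq : ((⌈C * Real.log Λ⌉₊ : ℕ) : ℝ) + 3 ≤ C' * (-Real.log ρ)) (hθ : 0 < θ) (hθ1 : θ < 1) (hCr : 0 ≤ Cr)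
    (hx : 0 ≤ x) (hc : 0 ≤ c)
    (hSB : RemnantSplitBudget l₀ vol T Acore Bcore Bad Cc Rr CcRec RrRec RrRem ν u' s₂ c₀ r' s)
    -- ─── in the slot of `hsteps`: the producer's binders (uniform / per cutoff / per term) ───
    {Akp Rkp r₁ skp κ₀ Kkp c₁ bkp τkp νkp : ℝ}
    (hAkp : 0 ≤ Akp) (hKkp : 0 ≤ Kkp) (hτkp : 0 ≤ τkp) (hr₁ : 0 ≤ r₁) (hskp : 0 ≤ skp) (hbkp : 0 ≤ bkp)
    (hrate' : κ₀ + (r₁ + skp) + τkp * c₁ ≤ Rkp) (hsmall : Akp * Real.exp (bkp + τkp * c₁) * Kkp * νkp ≤ τkp)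
    (hdd : 1 ≤ dd) {ce cs p₀ : ℝ} (hce : 0 < ce) (hp : 0 < p₀) (hP5 : ce ≤ cs * p₀)
    (F : ℕ → Flow) {β' : ℝ} (hβ' : 0 ≤ β') (hL : 1 ≤ Lb)
    (hpos : ∀ K j, j ≤ K → 0 < (F K).g j) (hle1 : ∀ K j, j ≤ K → (F K).g j ≤ 1) (hrg : ∀ K, (F K).SatisfiesRG K)
    (hub : ∀ K j, j < K → (F K).β (j + 1) ((F K).g j) ≤ β') (Rw : ℕ → ℕ → ℕ)
    (hRj : ∀ K j, j ≤ K → B14.IsRj Lb rr ((F K).g j) (Rw K j))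
    (hxK : ∀ K, Real.log (((F K).g K) ^ 2)⁻¹ ≤ x) (hcK : ∀ K, ((F K).g K) ^ 2 * β' ≤ c)
    {Nsz : ℕ} (hNsz : 64 ≤ Nsz)
    {Cat Disc : (K : ℕ) → ℝ → ι → ℕ → Finset (Dom K)}
    {cubes out reach : (K : ℕ) → ℝ → ι → ℕ → Dom K → Finset (Cube K)} {dsz : (K : ℕ) → ℝ → ι → ℕ → Dom K → ℝ}
    {wA wB : (K : ℕ) → ℝ → ι → ℕ → Dom K → ℂ}
    (Gl : (K : ℕ) → ℝ → ι → ℕ → Dom K → GeoLedger dd κ η) (birth : (K : ℕ) → ℝ → ι → ℕ → Dom K → ℕ)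
    (Clean : (K : ℕ) → ℝ → ι → ℕ → Dom K → ℕ → ℕ → Prop) {Qy Qo : (K : ℕ) → ℝ → ι → ℕ → Finset (Cube K)}
    (led : ℕ → ℝ → ι → Ledger ιL Op) (rem : ℕ → ℝ → ι → ℕ → Finset ιL)
    (dom : (K : ℕ) → ℝ → ι → ιL → Finset (Cube K))
    (hDisc : ∀ K t, |t| ≤ l₀ → ∀ τ ∈ T K \ Bad K t, ∀ j, Disc K t τ j ⊆ Cat K t τ j)
    (hloc : ∀ K t, |t| ≤ l₀ → ∀ τ ∈ T K \ Bad K t,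
      ∀ j Z, ∀ Z' ∈ Cat K t τ j, inc K Z' Z → ∃ q ∈ reach K t τ j Z, q ∈ out K t τ j Z')
    (hreach : ∀ K t, |t| ≤ l₀ → ∀ τ ∈ T K \ Bad K t,
      ∀ j Z, ((reach K t τ j Z).card : ℝ) ≤ νkp * (out K t τ j Z).card)
    (hdsz : ∀ K t, |t| ≤ l₀ → ∀ τ ∈ T K \ Bad K t, ∀ j Z, 0 ≤ dsz K t τ j Z)
    (hwAΛ : ∀ K t, |t| ≤ l₀ → ∀ τ ∈ T K \ Bad K t, ∀ j Z, Z ∉ Cat K t τ j → wA K t τ j Z = 0)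
    (hwBΛ : ∀ K t, |t| ≤ l₀ → ∀ τ ∈ T K \ Bad K t, ∀ j Z, Z ∉ Cat K t τ j → wB K t τ j Z = 0)
    (hwA : ∀ K t, |t| ≤ l₀ → ∀ τ ∈ T K \ Bad K t,
      ∀ j Z, ‖wA K t τ j Z‖ ≤ Akp * Real.exp (-(Rkp * dsz K t τ j Z)))
    (hwB : ∀ K t, |t| ≤ l₀ → ∀ τ ∈ T K \ Bad K t,
      ∀ j Z, ‖wB K t τ j Z‖ ≤ Akp * Real.exp (-(Rkp * dsz K t τ j Z)))
    (hzero : ∀ K t, |t| ≤ l₀ → ∀ τ ∈ T K \ Bad K t,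
      ∀ j, ∀ Z ∈ Cat K t τ j, Z ∉ Disc K t τ j → wA K t τ j Z = wB K t τ j Z)
    (hbirth : ∀ K t, |t| ≤ l₀ → ∀ τ ∈ T K \ Bad K t, ∀ j ∈ Icc (jlogOf C K) K, ∀ Z ∈ Disc K t τ j,
      BankYoung₂ (Gl K t τ j Z) ce cs p₀ C' K →
        ‖wA K t τ j Z - wB K t τ j Z‖ ≤ Cr * θ ^ birth K t τ j Z * (Akp * Real.exp (-(Rkp * dsz K t τ j Z))))
    (hhost : ∀ K t, |t| ≤ l₀ → ∀ τ ∈ T K \ Bad K t, ∀ j ∈ Icc (jlogOf C K) K, ∀ Z ∈ Disc K t τ j,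
      BankYoung₂ (Gl K t τ j Z) ce cs p₀ C' K →
        Hosts (Gl K t τ j Z) (birth K t τ j Z) j Nsz (Rw K) (Clean K t τ j Z))
    (hsizeA : ∀ K t, |t| ≤ l₀ → ∀ τ ∈ T K \ Bad K t, ∀ j ∈ Icc (jlogOf C K) K, ∀ Z ∈ Disc K t τ j,
      ¬BankYoung₂ (Gl K t τ j Z) ce cs p₀ C' K →
        ‖wA K t τ j Z‖ ≤ ρ ^ ageCut C' K * (Akp * Real.exp (-(Rkp * dsz K t τ j Z))))
    (hsizeB : ∀ K t, |t| ≤ l₀ → ∀ τ ∈ T K \ Bad K t, ∀ j ∈ Icc (jlogOf C K) K, ∀ Z ∈ Disc K t τ j,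
      ¬BankYoung₂ (Gl K t τ j Z) ce cs p₀ C' K →
        ‖wB K t τ j Z‖ ≤ ρ ^ ageCut C' K * (Akp * Real.exp (-(Rkp * dsz K t τ j Z))))
    (h126 : ∀ K t, |t| ≤ l₀ → ∀ τ ∈ T K \ Bad K t, ∀ j, Ineq126 (Cat K t τ j) (out K t τ j) (dsz K t τ j) κ₀ Kkp)
    (hvol : ∀ K t, |t| ≤ l₀ → ∀ τ ∈ T K \ Bad K t, ∀ j, VolBound (Cat K t τ j) (out K t τ j) (dsz K t τ j) c₁)
    (hQy : ∀ K t, |t| ≤ l₀ → ∀ τ ∈ T K \ Bad K t, ∀ j ∈ Icc (jlogOf C K) K, ∀ Z ∈ Disc K t τ j,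
      BankYoung₂ (Gl K t τ j Z) ce cs p₀ C' K → ∃ q ∈ Qy K t τ j, q ∈ out K t τ j Z)
    (hQo : ∀ K t, |t| ≤ l₀ → ∀ τ ∈ T K \ Bad K t, ∀ j ∈ Icc (jlogOf C K) K, ∀ Z ∈ Disc K t τ j,
      ¬BankYoung₂ (Gl K t τ j Z) ce cs p₀ C' K → ∃ q ∈ Qo K t τ j, q ∈ out K t τ j Z)
    (hQyc : ∀ K t, |t| ≤ l₀ → ∀ τ ∈ T K \ Bad K t,
      ∀ j ∈ Icc (jlogOf C K) K, ((Qy K t τ j).card : ℝ) ≤ vol * Λ ^ (K - j))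
    (hQoc : ∀ K t, |t| ≤ l₀ → ∀ τ ∈ T K \ Bad K t,
      ∀ j ∈ Icc (jlogOf C K) K, ((Qo K t τ j).card : ℝ) ≤ vol * Λ ^ (K - j))
    (hnd : ∀ K t, |t| ≤ l₀ → ∀ τ ∈ T K \ Bad K t, (led K t τ).leaves.Nodup)
    (hinj : ∀ K t, |t| ≤ l₀ → ∀ τ ∈ T K \ Bad K t, ∀ j, Set.InjOn (dom K t τ) ↑(rem K t τ j))
    (hRem : ∀ K t, |t| ≤ l₀ → ∀ τ ∈ T K \ Bad K t,
      RrRem K t τ ≤ ∑ j ∈ Icc (jlogOf C K) K, (led K t τ).leafSum fun i => if i ∈ rem K t τ j then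
        ‖locR (inc K) (Cat K t τ j) (cubes K t τ j) (wA K t τ j) (dom K t τ i) -
          locR (inc K) (Cat K t τ j) (cubes K t τ j) (wB K t τ j) (dom K t τ i)‖ else 0)
    -- ─── the consumer's tail ───
    (hr : Summable r') (hu : Summable u') (hs : Summable s) (hs₂ : Summable s₂)
    (hZA : ∀ K t, |t| ≤ l₀ → T4GenFunBounds.schemeZ S os (K₀ + K) t = ∑ τ ∈ T K, A K t τ)
    (hZB : ∀ K t, |t| ≤ l₀ → T4GenFunBounds.schemeZ S os (K₀ + K + 1) t = ∑ τ ∈ T K, B K t τ) :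
    ∃ K₁, StringHybridNE7 S os l₀ vol (K₀ + K₁) :=
  stringHybridNE7_closure_fed_steps_youngWindow S os K₀ h0 h1 hV hC hA hB hDA hDB hL0 hLs hA0 hAlo hAhi hB0 hBlo hBhi
    hΛ (mul_nonneg (mul_nonneg hAkp (Real.exp_pos _).le) hKkp) hρ0 hρ1 hq hθ hθ1 (T4EpochSize.one_le_modelC dd) hx hc
    hSB
    (fun K t ht τ hτ =>
      steps_feed_of_twoRun_bankYoung (inc K) hθ hθ1.le hCr (hDisc K t ht τ hτ) (hloc K t ht τ hτ)
        (hreach K t ht τ hτ) (hdsz K t ht τ hτ) hAkp hKkp hτkp hρ0.le hr₁ hskp hbkp (hwAΛ K t ht τ hτ)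
        (hwBΛ K t ht τ hτ) (hwA K t ht τ hτ) (hwB K t ht τ hτ) (hzero K t ht τ hτ) hdd (Gl K t τ) hce hp hP5
        (birth K t τ) (hbirth K t ht τ hτ) (F K) hβ' hL (hpos K) (hle1 K) (hrg K) (hub K) (Rw K) (hRj K) hx hc
        (hxK K) (hcK K) hNsz (Clean K t τ) (hhost K t ht τ hτ) (hsizeA K t ht τ hτ) (hsizeB K t ht τ hτ)
        (h126 K t ht τ hτ) (hvol K t ht τ hτ) hrate' hsmall (hQy K t ht τ hτ) (hQo K t ht τ hτ) (hQyc K t ht τ hτ)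
        (hQoc K t ht τ hτ) (hnd K t ht τ hτ) (rem K t τ) (hinj K t ht τ hτ) (hRem K t ht τ hτ))
    hr hu hs hs₂ hZA hZB

end SchemeHosts

/-! ## §2 All strings into node U0, in the lineage's plug form -/

section Plug

open Missing T4Continuum T4Assembly

variable {G : Type*} [GaugeGroup G] [MeasurableSpace G] [RegularGaugeGroup G] [HaarData G] {O : Type*}

/-- **ALL STRINGS ⇒ THE NODE-U0 TARGETS, IN THE LINEAGE'S PLUG FORM** (`T4MatchingAssembly.hasContinuumLimit_of_hybridNE7`
with its per-string hypothesis taken in the shape `∃ vol K₀ K₁, 0 < vol ∧ StringHybridNE7 S os l₀ vol (K₀ + K₁)` that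
every per-string closure theorem of this lineage concludes — §1b, or any of `T4MatchingClosure(Rem|Fed|Young).
stringHybridNE7_closure_*`): for a torus scheme with `β_K ≥ 0` and measurable observables bounded by `1`, and `0 < l₀`,
the continuum limit of every joint expectation EXISTS along the full sequence of spacings, limit points are UNIQUE label
by label, and subsequential limit functionals AGREE.  CONDITIONAL on the per-string data — the cell's located new
estimates, none in print. [folklore] -/
theorem hasContinuumLimit_of_stringClosures (S : TorusScheme G O) (hβ : ∀ K, 0 ≤ S.β K)
    (hm : ∀ K o, Measurable (S.obs K o)) (h1 : ∀ K o U, |S.obs K o U| ≤ 1) {l₀ : ℝ} (hl₀ : 0 < l₀)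
    (h : ∀ os : List O, ∃ (vol : ℝ) (K₀ K₁ : ℕ), 0 < vol ∧ StringHybridNE7 S os l₀ vol (K₀ + K₁)) :
    HasContinuumLimit S ∧ HasUniqueLimitPoints S ∧ LimitPointsAgree S :=
  hasContinuumLimit_of_hybridNE7 S hβ hm h1 hl₀ fun os => by
    obtain ⟨vol, K₀, K₁, hvol, hH⟩ := h os
    exact ⟨vol, K₀ + K₁, hvol, hH⟩

end Plug

end Literature.MathematicalPhysics.QuantumFieldTheory.Balaban1983to89.T4MatchingClosureHosts
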